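import Summits.AtomisticToContinuum.Crystallization.Theorems.FrustratedLawDichotomyDoublingGap

/-!
# FrustratedLawDichotomy · crux `AperiodicFrustratedLawGap` (stmt-AtomisticToContinuum-27623) — LAW-LEVEL DOUBLING AT THE UNIT THRESHOLD
# (decomp-a2c, prover hand 2, generation 2; sharpening generation 0's threshold `2` to `1`)

Generation 0 settled the no-pair classes `K_w = {no atoms s, s' with ‖s − s' + w‖ < 2}` by the two-copy superposition (`FrustratedLawDichotomyDoubling{Stationary,Gap}`).
The threshold `2` only served to make every cross interaction negative; but `V_LJ(r) < 0` for EVERY `r ≥ 1` (`V_LJ(1) = −1/12`), so the same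
transport settles the larger UNIT classes `K¹_w = {no atoms with ‖s − s' + w‖ < 1}`: `isRootedHardCore_add_map_add_one` (hard core `min δ 1`),
`isPointStationaryLaw_doubled_one`, `cross_term_facts_one`, `eStar_lt_integral_rootEnergy_of_ae_unitNoPair` — proofs verbatim from generation 0 with
the constant replaced.  Consequence (file `…AperiodicGapUnitDenseDifferences`): counterexamples to the crux have a 1-RELATIVELY-DENSE difference set.
All `[folklore]`.
-/

noncomputable section

namespace Summit.AtomisticToContinuum.Crystallization.Theorems.FrustratedLawDichotomyFiniteClusterGap

open MeasureTheory Metric Set Filter ProbabilityTheory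
open scoped ENNReal Topology BigOperators
open Literature.MathematicalPhysics.StatisticalMechanics Literature.Probability.Process
open Summit.AtomisticToContinuum.Crystallization.Theorems.ChargedEnergyGapNegative (E3 eStar)
open Summit.AtomisticToContinuum.Crystallization.Theorems.BenjaminiSchrammLimit (measurableSet_setOf_isRootedHardCore)

section UnitDoubling

variable {δ : ℝ} {P : Measure (Measure E3)}

/-- `V_LJ(r) < 0` for every `r ≥ 1` (`V_LJ(1) = −1/12`, and `V_LJ < 0` beyond). [folklore] -/
theorem lennardJones_neg_of_one_le {r : ℝ} (hr : 1 ≤ r) : lennardJones r < 0 := by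
  rcases hr.eq_or_lt with h | h
  · rw [← h, lennardJones_one]; norm_num
  · exact lennardJones_neg h

/-- **Doubling preserves the hard core on the unit no-pair class `K¹_w`.**  If `μ` is a rooted `δ`-hard-core configuration (`δ > 0`) all of whose atoms `s, s'`
satisfy `1 ≤ ‖s − s' + w‖`, then `μ + μ.map (· + w)` is a rooted `min δ 1`-hard-core configuration. [folklore] -/
theorem isRootedHardCore_add_map_add_one (hδ : 0 < δ) {μ : Measure E3} (hμ : IsRootedHardCore δ μ) {w : E3}
    (hK : ∀ s s' : E3, μ {s} ≠ 0 → μ {s'} ≠ 0 → 1 ≤ ‖s - s' + w‖) :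
    IsRootedHardCore (min δ 1) (μ + μ.map (fun z => z + w)) := by
  obtain ⟨S, h0, hsep, rfl⟩ := hμ
  have hK' : ∀ s ∈ S, ∀ s' ∈ S, 1 ≤ ‖s - s' + w‖ := fun s hs s' hs' =>
    hK s s' ((count_restrict_singleton_ne_zero_iff S s).2 hs) ((count_restrict_singleton_ne_zero_iff S s').2 hs')
  -- the copy is far from the original
  have hcross : ∀ s ∈ S, ∀ s' ∈ S, 1 ≤ dist s (s' + w) := fun s hs s' hs' => by
    rw [dist_eq_norm, show s - (s' + w) = -(s' - s + w) by abel, norm_neg]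
    exact hK' s' hs' s hs
  have hdisj : Disjoint S ((fun z => z + w) '' S) := by
    refine Set.disjoint_left.2 fun s hs hs' => ?_
    obtain ⟨s', hs'S, rfl⟩ := hs'
    have := hcross (s' + w) hs s' hs'S
    rw [dist_self] at this
    norm_num at this
  have hSm : MeasurableSet ((fun z : E3 => z + w) '' S) := by
    have : (fun z : E3 => z + w) '' S = (fun z : E3 => z - w) ⁻¹' S := by
      ext z
      constructor
      · rintro ⟨s, hs, rfl⟩
        simpa using hs
      · intro hz
        exact ⟨z - w, hz, by abel⟩
    rw [this]
    exact (measurable_sub_const w) (Metric.isClosed_of_pairwise_le_dist hδ hsep).measurableSet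
  refine ⟨S ∪ (fun z => z + w) '' S, Or.inl h0, ?_, ?_⟩
  · rintro x (hx | ⟨s, hs, rfl⟩) y (hy | ⟨s', hs', rfl⟩) hxy
    · exact (min_le_left _ _).trans (hsep x hx y hy hxy)
    · exact (min_le_right _ _).trans (hcross x hx s' hs')
    · rw [dist_comm]; exact (min_le_right _ _).trans (hcross y hy s hs)
    · rw [dist_add_right]
      exact (min_le_left _ _).trans (hsep s hs s' hs' fun h => hxy (by rw [h]))
  · rw [map_add_count_restrict, Measure.restrict_union hdisj hSm]

/-- **The doubled law is point-stationary.**  Let `P` be point-stationary and almost surely carried by rooted `δ`-hard-core configurations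
all of whose atoms satisfy `1 ≤ ‖s − s' + w‖`.  Then `P ∘ D_w⁻¹ + P ∘ D_{-w}⁻¹`, `D_{±w} μ = μ + μ.map (· ± w)`, is point-stationary.
[folklore] -/
theorem isPointStationaryLaw_doubled_one (hδ : 0 < δ) (hcore : ∀ᵐ μ ∂P, IsRootedHardCore δ μ) (hstat : IsPointStationaryLaw P) (w : E3)
    (hK : ∀ᵐ μ ∂P, ∀ s s' : E3, μ {s} ≠ 0 → μ {s'} ≠ 0 → 1 ≤ ‖s - s' + w‖) :
    IsPointStationaryLaw (P.map (fun μ : Measure E3 => μ + μ.map (fun z => z + w)) +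
      P.map (fun μ : Measure E3 => μ + μ.map (fun z => z + -w))) := by
  intro g hg
  have hδ' : 0 < min δ 1 := lt_min hδ one_pos
  -- the class is symmetric under `w ↦ -w`
  have hKm : ∀ᵐ μ ∂P, ∀ s s' : E3, μ {s} ≠ 0 → μ {s'} ≠ 0 → 1 ≤ ‖s - s' + -w‖ := by
    filter_upwards [hK] with μ hμ s s' hs hs'
    rw [show s - s' + -w = -(s' - s + w) by abel, norm_neg]
    exact hμ s' s hs' hs
  -- hard core of the doubled configurations
  have hHC : ∀ u : E3, (∀ᵐ μ ∂P, ∀ s s' : E3, μ {s} ≠ 0 → μ {s'} ≠ 0 → 1 ≤ ‖s - s' + u‖) →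
      ∀ᵐ μ ∂P, IsRootedHardCore (min δ 1) (μ + μ.map (fun z => z + u)) := fun u hu => by
    filter_upwards [hcore, hu] with μ hμ hμu
    exact isRootedHardCore_add_map_add_one hδ hμ hμu
  have hHCmap : ∀ u : E3, (∀ᵐ μ ∂P, ∀ s s' : E3, μ {s} ≠ 0 → μ {s'} ≠ 0 → 1 ≤ ‖s - s' + u‖) →
      ∀ᵐ ν ∂(P.map (fun μ : Measure E3 => μ + μ.map (fun z => z + u))), IsRootedHardCore (min δ 1) ν := fun u hu =>
    (ae_map_iff (measurable_add_map_add u).aemeasurable (measurableSet_setOf_isRootedHardCore hδ')).2 (hHC u hu)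
  -- the two Campbell functionals of the Mecke identity
  set Φ : Measure E3 → ℝ≥0∞ := fun ν => ∫⁻ y, g ν y ∂ν with hΦ
  set Ψ : Measure E3 → ℝ≥0∞ := fun ν => ∫⁻ y, g (ν.map fun z => z - y) (-y) ∂ν with hΨ
  -- evaluation of both along one doubling map: two Mecke identities for `P` each
  have hside : ∀ u : E3, (∀ᵐ μ ∂P, ∀ s s' : E3, μ {s} ≠ 0 → μ {s'} ≠ 0 → 1 ≤ ‖s - s' + u‖) →
      (∫⁻ ν, Φ ν ∂(P.map (fun μ : Measure E3 => μ + μ.map (fun z => z + u))) =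
        ∫⁻ μ, ∫⁻ y, g (μ.map (fun z => z - y) + (μ.map (fun z => z - y)).map (fun z => z + u)) (-y) ∂μ ∂P +
        ∫⁻ μ, ∫⁻ y, g (μ.map (fun z => z - y) + (μ.map (fun z => z - y)).map (fun z => z + u)) (-y + u) ∂μ ∂P) ∧
      (∫⁻ ν, Ψ ν ∂(P.map (fun μ : Measure E3 => μ + μ.map (fun z => z + u))) =
        ∫⁻ μ, ∫⁻ y, g (μ.map (fun z => z - y) + (μ.map (fun z => z - y)).map (fun z => z + u)) (-y) ∂μ ∂P +
        ∫⁻ μ, ∫⁻ y, g (μ.map (fun z => z - y) + (μ.map (fun z => z - y)).map (fun z => z + -u)) (-y + -u) ∂μ ∂P) := by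
    intro u hu
    have hDm : Measurable fun μ : Measure E3 => μ + μ.map (fun z => z + u) := measurable_add_map_add u
    -- payloads for the Mecke identity of `P`
    have hG₁ : Measurable (Function.uncurry fun (μ : Measure E3) (y : E3) => g (μ + μ.map (fun z => z + u)) y) :=
      hg.comp ((hDm.comp measurable_fst).prodMk measurable_snd)
    have hG₂ : Measurable (Function.uncurry fun (μ : Measure E3) (y : E3) => g (μ + μ.map (fun z => z + u)) (y + u)) :=
      hg.comp ((hDm.comp measurable_fst).prodMk (measurable_snd.add_const u))
    constructor
    · -- `Φ ∘ D_u = ∫ G₁ dμ + ∫ G₂ dμ`, then Mecke for `G₁`, `G₂`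
      rw [lintegral_map' (aemeasurable_lintegral_of_ae_hardCore hδ' (hHCmap u hu) hg) hDm.aemeasurable]
      have hsplit : (fun μ : Measure E3 => Φ (μ + μ.map (fun z => z + u))) = fun μ =>
          ∫⁻ y, g (μ + μ.map (fun z => z + u)) y ∂μ + ∫⁻ y, g (μ + μ.map (fun z => z + u)) (y + u) ∂μ := by
        funext μ
        have hsec : Measurable (fun y : E3 => g (μ + μ.map (fun z => z + u)) y) := hg.comp measurable_prodMk_left
        simp only [hΦ]
        rw [lintegral_add_measure, lintegral_map hsec (measurable_add_const u)]
      show ∫⁻ μ, Φ (μ + μ.map (fun z => z + u)) ∂P = _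
      rw [hsplit, lintegral_add_left' (aemeasurable_lintegral_of_ae_hardCore hδ hcore hG₁), hstat _ hG₁, hstat _ hG₂]
    · -- `Ψ ∘ D_u`: split the doubled measure, re-root inside (`θ_y D_u = D_u θ_y`, `θ_{y+u} D_u = D_{-u} θ_y`)
      rw [lintegral_map' (aemeasurable_lintegral_reroot_of_ae_hardCore hδ' (hHCmap u hu) hg) hDm.aemeasurable]
      have hsplit : ∀ᵐ μ ∂P, Ψ (μ + μ.map (fun z => z + u)) =
          ∫⁻ y, g (μ.map (fun z => z - y) + (μ.map (fun z => z - y)).map (fun z => z + u)) (-y) ∂μ +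
          ∫⁻ y, g (μ.map (fun z => z - y) + (μ.map (fun z => z - y)).map (fun z => z + -u)) (-(y + u)) ∂μ := by
        filter_upwards [hHC u hu] with μ hμ
        simp only [hΨ]
        rw [lintegral_add_measure, lintegral_map (measurable_reroot_section hδ' hμ hg) (measurable_add_const u)]
        simp only [map_sub_add_add_map_add]
        simp only [map_sub_add_map_add]
      show ∫⁻ μ, Ψ (μ + μ.map (fun z => z + u)) ∂P = _
      rw [lintegral_congr_ae hsplit]
      -- the first summand is the Mecke right-hand side for the payload `G₁`: a.e.-measurable
      have hA : AEMeasurable (fun μ : Measure E3 =>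
          ∫⁻ y, g (μ.map (fun z => z - y) + (μ.map (fun z => z - y)).map (fun z => z + u)) (-y) ∂μ) P := by
        have := aemeasurable_lintegral_reroot_of_ae_hardCore hδ hcore hG₁
        exact this
      rw [lintegral_add_left' hA]
      simp only [neg_add]
  -- assemble: four Mecke identities, matched pairwise
  obtain ⟨hΦp, hΨp⟩ := hside w hK
  obtain ⟨hΦm, hΨm⟩ := hside (-w) hKm
  rw [lintegral_add_measure, lintegral_add_measure, hΦp, hΨp, hΦm, hΨm]
  simp only [neg_neg]
  abel


/-- **The cross term of a configuration in `K_u`.**  For a rooted `δ`-hard-core `μ` whose atoms satisfy `1 ≤ ‖s − s' + u‖`: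
the Lennard-Jones field is integrable under the doubled configuration, the root energy of the doubled configuration splits as
`∫ V(‖z‖) d(D_u μ) = ∫ V(‖z‖) dμ + ∫ V(‖z + u‖) dμ`, the cross term is STRICTLY negative, and its negative part is bounded by the shell bound of
the doubled configuration. [folklore] -/
theorem cross_term_facts_one (hδ : 0 < δ) {μ : Measure E3} (hμ : IsRootedHardCore δ μ) {u : E3}
    (hK : ∀ s s' : E3, μ {s} ≠ 0 → μ {s'} ≠ 0 → 1 ≤ ‖s - s' + u‖) :
    Integrable (fun z : E3 => lennardJones ‖z + u‖) μ ∧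
    ∫ z, lennardJones ‖z‖ ∂(μ + μ.map (fun z => z + u)) = ∫ z, lennardJones ‖z‖ ∂μ + ∫ z, lennardJones ‖z + u‖ ∂μ ∧
    ∫ z, lennardJones ‖z + u‖ ∂μ < 0 ∧
    ∫⁻ z, ENNReal.ofReal (-lennardJones ‖z + u‖) ∂μ ≤ ENNReal.ofReal (250 / 6 * (min δ 1)⁻¹ ^ 6) ∧
    ∫⁻ z, ENNReal.ofReal (lennardJones ‖z + u‖) ∂μ = 0 := by
  have hδ' : 0 < min δ 1 := lt_min hδ one_pos
  have hD := isRootedHardCore_add_map_add_one hδ hμ hK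
  have hLJm : Measurable fun y : E3 => lennardJones ‖y‖ := by
    have : Measurable lennardJones := by unfold lennardJones; fun_prop
    exact this.comp measurable_norm
  -- integrability under the doubled configuration (a rooted `min δ 1`-hard-core configuration), via a one-atom law
  have hintD : Integrable (fun z : E3 => lennardJones ‖z‖) (μ + μ.map (fun z => z + u)) := by
    haveI : IsFiniteMeasure (Measure.dirac (μ + μ.map (fun z => z + u)) : Measure (Measure E3)) := by infer_instance
    obtain ⟨T, h0T, hsepT, hT⟩ := hD
    obtain ⟨hp, hm⟩ := measurable_ofReal_lennardJones_parts
    have hb := lintegral_lennardJones_parts_map_sub_le hδ' hsepT h0T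
    simp only [sub_zero, Measure.map_id'] at hb
    rw [hT]
    refine ⟨hLJm.aestronglyMeasurable, ?_⟩
    show ∫⁻ y, ‖lennardJones ‖y‖‖ₑ ∂((Measure.count : Measure E3).restrict T) < ∞
    calc ∫⁻ y, ‖lennardJones ‖y‖‖ₑ ∂((Measure.count : Measure E3).restrict T)
        ≤ ∫⁻ y, (ENNReal.ofReal (lennardJones ‖y‖) + ENNReal.ofReal (-lennardJones ‖y‖)) ∂((Measure.count : Measure E3).restrict T) :=
          lintegral_mono fun y => by
            rw [Real.enorm_eq_ofReal_abs]
            rcases le_total 0 (lennardJones ‖y‖) with h | h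
            · rw [abs_of_nonneg h]; exact le_self_add
            · rw [abs_of_nonpos h]; exact le_add_self
      _ = (∫⁻ y, ENNReal.ofReal (lennardJones ‖y‖) ∂((Measure.count : Measure E3).restrict T)) +
            ∫⁻ y, ENNReal.ofReal (-lennardJones ‖y‖) ∂((Measure.count : Measure E3).restrict T) := lintegral_add_left hp _
      _ < ∞ := ENNReal.add_lt_top.2 ⟨hb.1.trans_lt ENNReal.ofReal_lt_top, hb.2.trans_lt ENNReal.ofReal_lt_top⟩
  have hintμ : Integrable (fun z : E3 => lennardJones ‖z‖) μ := hintD.mono_measure (Measure.le_add_right le_rfl)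
  have hintmap : Integrable (fun z : E3 => lennardJones ‖z‖) (μ.map (fun z => z + u)) :=
    hintD.mono_measure (Measure.le_add_left le_rfl)
  have hintu : Integrable (fun z : E3 => lennardJones ‖z + u‖) μ :=
    (integrable_map_measure hLJm.aestronglyMeasurable (measurable_add_const u).aemeasurable).1 hintmap
  -- the splitting
  have hsplit : ∫ z, lennardJones ‖z‖ ∂(μ + μ.map (fun z => z + u)) = ∫ z, lennardJones ‖z‖ ∂μ + ∫ z, lennardJones ‖z + u‖ ∂μ := by
    rw [integral_add_measure hintμ hintmap, integral_map (measurable_add_const u).aemeasurable hLJm.aestronglyMeasurable]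
  -- negativity and the bounds on the cross term
  obtain ⟨S, h0, hsep, rfl⟩ := hμ
  have hK' : ∀ z ∈ S, 1 ≤ ‖z + u‖ := fun z hz => by
    have := hK z 0 ((count_restrict_singleton_ne_zero_iff S z).2 hz) ((count_restrict_singleton_ne_zero_iff S 0).2 h0)
    simpa using this
  have hneg_pt : ∀ z ∈ S, lennardJones ‖z + u‖ < 0 := fun z hz => lennardJones_neg_of_one_le (hK' z hz)
  have hae : ∀ᵐ z ∂((Measure.count : Measure E3).restrict S), z ∈ S := ae_mem_of_sep hδ hsep
  refine ⟨hintu, hsplit, ?_, ?_, ?_⟩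
  · -- strictly negative: `-∫ (-f) < 0` with `-f > 0` on the atom `0`
    have hpos : 0 < ∫ z, -lennardJones ‖z + u‖ ∂((Measure.count : Measure E3).restrict S) := by
      rw [integral_pos_iff_support_of_nonneg_ae (hae.mono fun z hz => (neg_pos.2 (hneg_pt z hz)).le) hintu.neg]
      refine lt_of_lt_of_le ?_ (measure_mono (show ({0} : Set E3) ⊆ Function.support fun z => -lennardJones ‖z + u‖ from ?_))
      · rw [Measure.restrict_apply (measurableSet_singleton 0), Set.inter_eq_left.2 (Set.singleton_subset_iff.2 h0),
          Measure.count_singleton]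
        exact one_pos
      · intro z hz
        rw [Set.mem_singleton_iff.1 hz, Function.mem_support]
        exact (neg_pos.2 (hneg_pt 0 h0)).ne'
    rw [integral_neg] at hpos
    linarith
  · -- negative part: bounded by the shell bound of the doubled configuration
    obtain ⟨T, h0T, hsepT, hT⟩ := hD
    have hb := (lintegral_lennardJones_parts_map_sub_le hδ' hsepT h0T).2
    simp only [sub_zero, Measure.map_id'] at hb
    calc ∫⁻ z, ENNReal.ofReal (-lennardJones ‖z + u‖) ∂((Measure.count : Measure E3).restrict S)
        = ∫⁻ z, ENNReal.ofReal (-lennardJones ‖z‖) ∂(((Measure.count : Measure E3).restrict S).map (fun z => z + u)) :=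
          (lintegral_map measurable_ofReal_lennardJones_parts.2 (measurable_add_const u)).symm
      _ ≤ ∫⁻ z, ENNReal.ofReal (-lennardJones ‖z‖) ∂((Measure.count : Measure E3).restrict S +
            ((Measure.count : Measure E3).restrict S).map (fun z => z + u)) := lintegral_mono' (Measure.le_add_left le_rfl) le_rfl
      _ ≤ ENNReal.ofReal (250 / 6 * (min δ 1)⁻¹ ^ 6) := by rw [hT]; exact hb
  · -- positive part vanishes: all atoms of the copy are at distance `≥ 1`
    refine (lintegral_eq_zero_iff' ((measurable_ofReal_lennardJones_parts.1.comp (measurable_add_const u)).aemeasurable)).2 ?_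
    exact hae.mono fun z hz => by simp only [Pi.zero_apply]; exact ENNReal.ofReal_of_nonpos (hneg_pt z hz).le


/-- `e⋆ < 0`. [folklore] -/
private theorem eStar_neg₇ : eStar < 0 := by
  have h := card_mul_eStar_lt_interactionEnergy (N := 1) one_pos (x := fun _ => (0 : E3)) (fun i j _ => Subsingleton.elim i j)
  rw [interactionEnergy_of_subsingleton] at h
  simpa using h

/-- **The UNIT no-pair class `K¹_w` is settled** (threshold `1` in place of generation 0's `2`: `V_LJ(r) < 0` already for `r ≥ 1`).  Granted the energy floor for point-stationary hard-core probability laws (item 9229, PROVED in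
the tree; hypothesis in Literature vocabulary), every point-stationary `δ`-hard-core probability law almost surely carried by configurations
whose atoms satisfy `1 ≤ ‖s − s' + w‖` for all atoms `s, s'` has mean root energy STRICTLY above `e⋆`. [folklore] -/
theorem eStar_lt_integral_rootEnergy_of_ae_unitNoPair
    (hU : ∀ δ' : ℝ, 0 < δ' → ∀ Q : Measure (Measure E3), IsProbabilityMeasure Q → (∀ᵐ μ ∂Q, IsRootedHardCore δ' μ) →
      IsPointStationaryLaw Q → eStar ≤ ∫ μ, rootEnergy lennardJones μ ∂Q)
    (hδ : 0 < δ) [IsProbabilityMeasure P] (hcore : ∀ᵐ μ ∂P, IsRootedHardCore δ μ) (hstat : IsPointStationaryLaw P) (w : E3)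
    (hK : ∀ᵐ μ ∂P, ∀ s s' : E3, μ {s} ≠ 0 → μ {s'} ≠ 0 → 1 ≤ ‖s - s' + w‖) :
    eStar < ∫ μ, rootEnergy lennardJones μ ∂P := by
  -- junk case
  by_cases hint : Integrable (fun μ : Measure E3 => rootEnergy lennardJones μ) P
  swap
  · rw [integral_undef hint]; exact eStar_neg₇
  have hδ' : 0 < min δ 1 := lt_min hδ one_pos
  have hKm : ∀ᵐ μ ∂P, ∀ s s' : E3, μ {s} ≠ 0 → μ {s'} ≠ 0 → 1 ≤ ‖s - s' + -w‖ := by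
    filter_upwards [hK] with μ hμ s s' hs hs'
    rw [show s - s' + -w = -(s' - s + w) by abel, norm_neg]
    exact hμ s' s hs' hs
  -- per doubling map: hard core a.s., mass, and the energy identity `∫ h d(P∘D_u⁻¹) = ∫ h dP + ½ ∫ C_u dP` with `∫ C_u dP < 0`
  have hside : ∀ u : E3, (∀ᵐ μ ∂P, ∀ s s' : E3, μ {s} ≠ 0 → μ {s'} ≠ 0 → 1 ≤ ‖s - s' + u‖) →
      (∀ᵐ ν ∂(P.map (fun μ : Measure E3 => μ + μ.map (fun z => z + u))), IsRootedHardCore (min δ 1) ν) ∧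
      (P.map (fun μ : Measure E3 => μ + μ.map (fun z => z + u))) univ = 1 ∧
      Integrable (fun ν => rootEnergy lennardJones ν) (P.map (fun μ : Measure E3 => μ + μ.map (fun z => z + u))) ∧
      ∃ c : ℝ, c < 0 ∧ ∫ ν, rootEnergy lennardJones ν ∂(P.map (fun μ : Measure E3 => μ + μ.map (fun z => z + u))) =
        ∫ μ, rootEnergy lennardJones μ ∂P + c := by
    intro u hu
    have hDm : Measurable fun μ : Measure E3 => μ + μ.map (fun z => z + u) := measurable_add_map_add u
    have hHC : ∀ᵐ μ ∂P, IsRootedHardCore (min δ 1) (μ + μ.map (fun z => z + u)) := by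
      filter_upwards [hcore, hu] with μ hμ hμu
      exact isRootedHardCore_add_map_add_one hδ hμ hμu
    have hHCmap : ∀ᵐ ν ∂(P.map (fun μ : Measure E3 => μ + μ.map (fun z => z + u))), IsRootedHardCore (min δ 1) ν :=
      (ae_map_iff hDm.aemeasurable (measurableSet_setOf_isRootedHardCore hδ')).2 hHC
    have hmass : (P.map (fun μ : Measure E3 => μ + μ.map (fun z => z + u))) univ = 1 := by
      rw [Measure.map_apply hDm MeasurableSet.univ, Set.preimage_univ, measure_univ]
    haveI : IsFiniteMeasure (P.map (fun μ : Measure E3 => μ + μ.map (fun z => z + u))) :=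
      ⟨by rw [hmass]; exact ENNReal.one_lt_top⟩
    have hintD : Integrable (fun ν => rootEnergy lennardJones ν) (P.map (fun μ : Measure E3 => μ + μ.map (fun z => z + u))) :=
      integrable_rootEnergy_of_ae_hardCore hδ' hHCmap
    refine ⟨hHCmap, hmass, hintD, ?_⟩
    -- the cross term as a function of the configuration: measurable version and a.e. facts
    obtain ⟨hp, hm⟩ := measurable_ofReal_lennardJones_parts
    set Cr : Measure E3 → ℝ := fun μ =>
      (∫⁻ z, ENNReal.ofReal (lennardJones ‖z + u‖) ∂μ).toReal - (∫⁻ z, ENNReal.ofReal (-lennardJones ‖z + u‖) ∂μ).toReal with hCr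
    have hCrm : Measurable Cr :=
      (Measure.measurable_lintegral (hp.comp (measurable_add_const u))).ennreal_toReal.sub
        (Measure.measurable_lintegral (hm.comp (measurable_add_const u))).ennreal_toReal
    have hfacts : ∀ᵐ μ ∂P, rootEnergy lennardJones (μ + μ.map (fun z => z + u)) = rootEnergy lennardJones μ + Cr μ / 2 ∧
        Cr μ < 0 ∧ |Cr μ| ≤ (ENNReal.ofReal (250 / 6 * (min δ 1)⁻¹ ^ 6)).toReal := by
      filter_upwards [hcore, hu] with μ hμ hμu
      obtain ⟨hintu, hsplit, hneg, hbd, hzero⟩ := cross_term_facts_one hδ hμ hμu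
      have hC : ∫ z, lennardJones ‖z + u‖ ∂μ = Cr μ := by
        rw [hCr, integral_eq_lintegral_pos_part_sub_lintegral_neg_part hintu]
      refine ⟨?_, ?_, ?_⟩
      · rw [rootEnergy_def, rootEnergy_def, hsplit, hC]; ring
      · rw [← hC]; exact hneg
      · rw [← hC]
        have h1 : ∫ z, lennardJones ‖z + u‖ ∂μ =
            (∫⁻ z, ENNReal.ofReal (lennardJones ‖z + u‖) ∂μ).toReal - (∫⁻ z, ENNReal.ofReal (-lennardJones ‖z + u‖) ∂μ).toReal :=
          integral_eq_lintegral_pos_part_sub_lintegral_neg_part hintu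
        rw [h1, hzero, ENNReal.toReal_zero, zero_sub, abs_neg, abs_of_nonneg ENNReal.toReal_nonneg]
        exact ENNReal.toReal_mono ENNReal.ofReal_ne_top hbd
    have hCint : Integrable Cr P :=
      Integrable.of_bound hCrm.aestronglyMeasurable _ (hfacts.mono fun μ h => by rw [Real.norm_eq_abs]; exact h.2.2)
    have hCneg : ∫ μ, Cr μ ∂P < 0 := by
      have hpos : 0 < ∫ μ, -Cr μ ∂P := by
        have h0 : 0 ≤ ∫ μ, -Cr μ ∂P :=
          integral_nonneg_of_ae (hfacts.mono fun μ h => by show (0 : ℝ) ≤ -Cr μ; linarith [h.2.1])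
        rcases h0.lt_or_eq with h | h
        · exact h
        · exfalso
          have hz := (integral_eq_zero_iff_of_nonneg_ae (hfacts.mono fun μ h => by
            show (0 : ℝ) ≤ -Cr μ; linarith [h.2.1]) hCint.neg).1 h.symm
          have hfalse : ∀ᵐ μ ∂P, False := by
            filter_upwards [hfacts, hz] with μ h1 h2
            simp only [Pi.zero_apply, Pi.neg_apply, neg_eq_zero] at h2
            linarith [h1.2.1]
          exact IsProbabilityMeasure.ne_zero P (ae_eq_bot.1 (Filter.eventually_false_iff_eq_bot.1 hfalse))
      rw [integral_neg] at hpos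
      linarith
    refine ⟨(∫ μ, Cr μ ∂P) / 2, by linarith, ?_⟩
    rw [integral_map hDm.aemeasurable hintD.aestronglyMeasurable,
      integral_congr_ae (hfacts.mono fun μ h => h.1), integral_add hint (hCint.div_const 2), integral_div]
  -- the symmetrised doubled law and the floor
  obtain ⟨hHCp, hmassp, hintp, cp, hcp, hEp⟩ := hside w hK
  obtain ⟨hHCm, hmassm, hintm, cm, hcm, hEm⟩ := hside (-w) hKm
  set Q : Measure (Measure E3) := P.map (fun μ : Measure E3 => μ + μ.map (fun z => z + w)) +
    P.map (fun μ : Measure E3 => μ + μ.map (fun z => z + -w)) with hQ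
  have hQ' : IsProbabilityMeasure ((2 : ℝ≥0∞)⁻¹ • Q) := ⟨by
    rw [Measure.smul_apply, hQ, Measure.add_apply, hmassp, hmassm, smul_eq_mul]
    norm_num
    exact ENNReal.inv_mul_cancel two_ne_zero ENNReal.ofNat_ne_top⟩
  have hfloor := hU (min δ 1) hδ' ((2 : ℝ≥0∞)⁻¹ • Q) hQ'
    (Measure.ae_smul_measure ((ae_add_measure_iff).2 ⟨hHCp, hHCm⟩) _)
    ((isPointStationaryLaw_doubled_one hδ hcore hstat w hK).smul _)
  rw [integral_smul_measure, hQ, integral_add_measure hintp hintm, hEp, hEm, ENNReal.toReal_inv, ENNReal.toReal_ofNat,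
    smul_eq_mul] at hfloor
  linarith


end UnitDoubling

end Summit.AtomisticToContinuum.Crystallization.Theorems.FrustratedLawDichotomyFiniteClusterGap

end
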